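import Summits.BirchSwinnertonDyer.Rank1Residual.Additive.CensusX41Calibration
import HarnessLib

/-!
# Census relation X4-1 ⟹ the `μ`-certificate of the Néron-normalised `χ_{p*}`-branch is FREE on the
# unit rows: `‖[T⁰](ϖ · L_p(f♭, α♭, ω^{(p−1)/2}, T))‖_p = |L(E,1)/Ω_E|_p` (cell `b2b-bsdres`, census
# cell, seat `b2b-bsdres-census-ctyper1`; for team n1011's certificate hypothesis `hcert`, census H-9/Q6)

HONEST FRAMING (cell `b2b-bsdres`, run/shared/lean/b2b/bsd-rank1-residual/, verbatim in every
file): the goal of the cell is to DELETE the COMBINATION-SHAPED residual classes of the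
Birch–Swinnerton-Dyer formula for ALL analytic-rank `≤ 1` elliptic curves over `ℚ` — "full BSD
formula for every rank `≤ 1` curve in class `C`" assembled STRICTLY from published theorems — so
that the rank-`≤ 1` remainder becomes exactly the CONSTRUCTION-SHAPED classes, which are TYPED
(missing-input `Prop`s), NOT attempted. This is not "finishing BSD". Census cell: research
instrumentation; census output = EVIDENCE / conjecture items, never a Literature fact; labels
UNCHANGED; nothing booked. Theorems only (no definition, no named fact).

## What

Team n1011's lower-half route on the defect-2 (G-ordinary) rows (`GordRatMainConjLowerBound.lean`,
p249422, and its odd twin `GordRatMainConjLowerBoundOdd.lean`) consumes, besides the typed rational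
branch main conjecture, ONE finite certificate per pair:

  `hcert : ∃ n, ‖[Tⁿ](ϖ · L_p(f♭, α♭, ω^{(p−1)/2}, T))‖_p = 1`

("`μ = 0` for the Néron-normalised branch"), which the census is asked to supply numerically (census
lead's CELL-PLAN §3 H-9 = n1011 Q6: "index of the first `p`-adic UNIT coefficient of the
Néron-normalised branch, two engines"). This file shows that on the UNIT ROWS — `L(E,1)/Ω_E` a
`p`-adic unit, i.e. `p ∤ #Ш_an·∏c_ℓ/#E(ℚ)²_tors` at rank `0` — the certificate holds with `n = 0`
and NO computation, as a corollary of the calibration relation X4-1 (`CensusX41Calibration.lean`):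
the constant coefficient of the Néron-normalised branch is `ϖ · α♭⁻¹ · S^±` (MTT (10.1)/(13),
`constantCoeff_padicLFunction[Minus]Branch_half`), `α♭` is a unit, and `ϖ·S⁺ = L(E,1)/Ω_E`
(`p ≡ 1 (mod 4)`) resp. `ϖ⁻·S⁻ = c_∞(E)·L(E,1)/Ω_E` (`p ≡ 3 (mod 4)`, `c_∞ ∈ {1,2}` a unit at odd `p`)
by Birch × Pal × Gauss (`entireLFunction_one_eq_of_twist_pos/_neg_signed`). Hence:

* `CensusX41.norm_coeff_zero_even/_odd` — `‖[T⁰](ϖ·L_p)‖ = ‖L(E,1)/Ω_E‖_p` (as the norm of the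
  rational `ϖ·S⁺`, resp. of `ϖ⁻·S⁻ = c_∞·(L(E,1)/Ω_E)`), together with the `L`-value identity;
* `CensusX41.unitCoeffCert_even/_odd` — if `L(E,1) = q·Ω_E` with `ord_p q = 0` then `hcert` holds
  with `n = 0`, in EXACTLY the binder shape of n1011-p06's class theorems
  (`ClassX4Gord.cycLowerLeadingTermAt_of_ratCharEq[Odd]_of_unitCoeff`: for all twist models `V`,
  changes of variables `C`, newforms `f`, period ratios `ϖ`).
So Q6's compute is informative only on the rows with `p ∣ L(E,1)/Ω_E` (there the first unit
coefficient has index `n ≥ 1` and needs the higher Riemann sums); on the unit rows the kernel already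
has the certificate. Nothing here touches the main-conjecture input `ChiBranchRatCharEq[Odd]At`.

References: Mazur–Tate–Teitelbaum 1986 §I.10 (10.1), §I.13–I.14 [MazurTateTeitelbaum1986Invent];
Pal 2012 Thm. 3.2 [Pal2012]; census bsd-formula-census `X41-REPORT.md` (sha256 `4b02e3e4…`, EVIDENCE
only), census lead `HOME/census/CELL-PLAN.md` §3 H-9.
-/

noncomputable section

open scoped Classical MatrixGroups ModularForm

open CongruenceSubgroup WeierstrassCurve Literature.NumberTheory.EllipticCurves
  Literature.NumberTheory.EllipticCurves.ModularForms
  Literature.NumberTheory.EllipticCurves.Rank1Residual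

namespace Summit.BirchSwinnertonDyer.Rank1Residual.Additive

variable (p : ℕ) [hp : Fact p.Prime]

omit hp in
/-- `‖r‖_p = 1` for a nonzero rational of `p`-adic valuation `0`. -/
private theorem norm_ratCast_eq_one_of_padicValRat_eq_zero [Fact p.Prime] {r : ℚ} (hr : r ≠ 0)
    (hv : padicValRat p r = 0) : ‖((r : ℚ) : ℚ_[p])‖ = 1 := by
  have hrQ : ((r : ℚ) : ℚ_[p]) ≠ 0 := by exact_mod_cast hr
  rw [Padic.norm_eq_zpow_neg_valuation hrQ, Padic.valuation_ratCast, hv, neg_zero, zpow_zero]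

/-! ### Rows `p ≡ 1 (mod 4)` (even branch) -/

/-- **Even rows: the constant coefficient of the Néron-normalised branch is `ϖ·α♭⁻¹·S⁺`, of norm
`‖ϖ·S⁺‖_p`, and `ϖ·S⁺ = L(E,1)/Ω_E`.** Setting: `E = W = C • V^{(p)}` additive at `p ≡ 1 (mod 4)`,
`V = E♭` good ORDINARY at `p` (unit root `α♭ = unitRoot V p`), newform `f`, `ϖ·Ω_V = Ω⁺_f`,
`S⁺ = ∑_{a mod p}(a/p)[a/p]⁺_f`. From `constantCoeff_padicLFunctionBranch_half` (MTT (10.1)/(13)),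
`‖α♭‖ = 1`, and `entireLFunction_one_eq_of_twist_pos` (Birch × Pal × Gauss).
[cite: MazurTateTeitelbaum1986Invent, §I.10 (10.1), §I.13] [cite: Pal2012, Thm. 3.2] -/
theorem CensusX41.norm_coeff_zero_even (hmod : hasEntireLFunction_rat) (hp4 : p % 4 = 1)
    (V W : WeierstrassCurve ℚ) [V.IsElliptic] [V.IsGloballyMinimal] [W.IsElliptic]
    [W.IsGloballyMinimal] (C : VariableChange ℚ) (hC : C • V.quadraticTwist (p : ℚ) = W)
    (hord : IsOrdinaryAt V p) (hadd : Addv W p)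
    {N : ℕ} [NeZero N] {f : CuspForm (Gamma0 N) 2} (hf : IsNewformOf V f)
    (ϖ : ℚ) (hϖ : (ϖ : ℝ) * V.realPeriodRat = plusPeriod f) :
    ‖PowerSeries.coeff 0
        (PowerSeries.C (ϖ : ℚ_[p]) * padicLFunctionBranch f (unitRoot V p : ℚ_[p]) (p / 2))‖ =
      ‖((ϖ * legendrePlusSymbolSum f p : ℚ) : ℚ_[p])‖ ∧
    W.entireLFunction 1 = ((ϖ * legendrePlusSymbolSum f p : ℚ) : ℂ) * (W.realPeriodRat : ℂ) := by
  have hp2 : p ≠ 2 := by omega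
  refine ⟨?_, entireLFunction_one_eq_of_twist_pos p hmod hp4 V W C hC (Or.inl hord.1) hadd hf ϖ hϖ⟩
  obtain ⟨-, hαn, hα0⟩ := unitRoot_coe_spec (W := V) hord
  rw [PowerSeries.coeff_C_mul, PowerSeries.coeff_zero_eq_constantCoeff,
    constantCoeff_padicLFunctionBranch_half p hp2 V hord hf]
  rw [norm_mul, norm_mul, norm_inv, hαn, inv_one, one_mul, Rat.cast_mul, norm_mul]

/-- **Even rows, the `μ`-certificate on the unit rows, FREE**: if `L(E,1) = q·Ω_E` with `q ≠ 0` and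
`ord_p q = 0` (at rank `0`: `p ∤ #Ш_an·∏c_ℓ/#E(ℚ)²_tors`), then the constant coefficient of
`ϖ·L_p(f♭, α♭, ω^{(p−1)/2}, T)` is a `p`-adic unit — n1011-p06's certificate `hcert` with `n = 0`, in
the binder shape of `ClassX4Gord.cycLowerLeadingTermAt_of_ratCharEq_of_unitCoeff` (every twist model
`V`, change of variables `C`, newform `f`, period ratio `ϖ`).
[cite: MazurTateTeitelbaum1986Invent, §I.13–I.14] [cite: Pal2012, Thm. 3.2] -/
theorem CensusX41.unitCoeffCert_even (hmod : hasEntireLFunction_rat) (hp4 : p % 4 = 1)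
    (W : WeierstrassCurve ℚ) [W.IsElliptic] [W.IsGloballyMinimal] (hadd : Addv W p)
    {q : ℚ} (hq : W.entireLFunction 1 = (q : ℂ) * (W.realPeriodRat : ℂ)) (hq0 : q ≠ 0)
    (hv : padicValRat p q = 0) :
    ∀ (V : WeierstrassCurve ℚ) [V.IsElliptic] [V.IsGloballyMinimal] (C : VariableChange ℚ),
      GoodOrd V p → C • V.quadraticTwist (p : ℚ) = W →
      ∀ {N : ℕ} [NeZero N] (f : CuspForm (Gamma0 N) 2), IsNewformOf V f →
      ∀ ϖ : ℚ, (ϖ : ℝ) * V.realPeriodRat = plusPeriod f →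
      ∃ n : ℕ, ‖PowerSeries.coeff n
        (PowerSeries.C (ϖ : ℚ_[p]) * padicLFunctionBranch f (unitRoot V p : ℚ_[p]) (p / 2))‖ = 1 := by
  intro V _ _ C hV hC N _ f hf ϖ hϖ
  have hord : IsOrdinaryAt V p := (isOrdinaryAt_iff V p).mpr ⟨hV.1, hV.2⟩
  obtain ⟨hnorm, hL⟩ := CensusX41.norm_coeff_zero_even p hmod hp4 V W C hC hord hadd hf ϖ hϖ
  refine ⟨0, ?_⟩
  -- `ϖ·S⁺ = q` since both are `L(E,1)/Ω_E`
  have hΩ : (W.realPeriodRat : ℂ) ≠ 0 := by exact_mod_cast W.realPeriodRat_pos_holds.ne'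
  have hqS : ϖ * legendrePlusSymbolSum f p = q := by
    have h : ((ϖ * legendrePlusSymbolSum f p : ℚ) : ℂ) = (q : ℂ) :=
      mul_right_cancel₀ hΩ (hL.symm.trans hq)
    exact_mod_cast h
  rw [hnorm, hqS]
  exact norm_ratCast_eq_one_of_padicValRat_eq_zero p hq0 hv

/-! ### Rows `p ≡ 3 (mod 4)` (odd branch) -/

/-- **Odd rows: the constant coefficient of the Néron-normalised minus branch is `ϖ⁻·α♭⁻¹·S⁻`, of
norm `‖ϖ⁻·S⁻‖_p`, and `ϖ⁻·S⁻ = c_∞(E)·L(E,1)/Ω_E`** (`E = W = C • V^{(−p)}`, `V = E♭` good ordinary at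
`p ≡ 3 (mod 4)`, `ϖ⁻·|Ω⁻(V)| = Ω⁻_f`; `constantCoeff_padicLFunctionMinusBranch_half`,
`entireLFunction_one_eq_of_twist_neg_signed`).
[cite: MazurTateTeitelbaum1986Invent, §I.10 (10.1), §I.13] [cite: Pal2012, Thm. 3.2] -/
theorem CensusX41.norm_coeff_zero_odd (hmod : hasEntireLFunction_rat) (hp4 : p % 4 = 3)
    (V W : WeierstrassCurve ℚ) [V.IsElliptic] [V.IsGloballyMinimal] [W.IsElliptic]
    [W.IsGloballyMinimal] (C : VariableChange ℚ) (hC : C • V.quadraticTwist (-(p : ℚ)) = W)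
    (hord : IsOrdinaryAt V p) (hadd : Addv W p)
    {N : ℕ} [NeZero N] {f : CuspForm (Gamma0 N) 2} (hf : IsNewformOf V f)
    (ϖ : ℚ) (hϖ : (ϖ : ℝ) * V.imaginaryPeriodRat = minusPeriod f) :
    ‖PowerSeries.coeff 0
        (PowerSeries.C (ϖ : ℚ_[p]) * padicLFunctionMinusBranch f (unitRoot V p : ℚ_[p]) (p / 2))‖ =
      ‖((ϖ * legendreMinusSymbolSum f p : ℚ) : ℚ_[p])‖ ∧
    W.entireLFunction 1 =
      ((ϖ * legendreMinusSymbolSum f p / ((W.baseChange ℝ).numRealComponents : ℚ) : ℚ) : ℂ) *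
        (W.realPeriodRat : ℂ) := by
  have hp2 : p ≠ 2 := by omega
  refine ⟨?_, entireLFunction_one_eq_of_twist_neg_signed p hmod hp4 V W C hC (Or.inl hord.1) hadd hf
    ϖ hϖ⟩
  obtain ⟨-, hαn, hα0⟩ := unitRoot_coe_spec (W := V) hord
  rw [PowerSeries.coeff_C_mul, PowerSeries.coeff_zero_eq_constantCoeff,
    constantCoeff_padicLFunctionMinusBranch_half p hp2 V hord hf]
  rw [norm_mul, norm_mul, norm_inv, hαn, inv_one, one_mul, Rat.cast_mul, norm_mul]

/-- **Odd rows, the `μ`-certificate on the unit rows, FREE**: if `L(E,1) = q·Ω_E` with `q ≠ 0` and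
`ord_p q = 0`, then the constant coefficient of `ϖ⁻·L_p⁻(f♭, α♭, ω^{(p−1)/2}, T)` is a `p`-adic unit
(`ϖ⁻·S⁻ = c_∞(E)·q` and `c_∞(E) ∈ {1,2}` is a unit at the odd prime `p`) — n1011-p06's certificate
`hcert` with `n = 0`, in the binder shape of
`ClassX4Gord.cycLowerLeadingTermAt_of_ratCharEqOdd_of_unitCoeff` (covers `p = 3`).
[cite: MazurTateTeitelbaum1986Invent, §I.13–I.14] [cite: Pal2012, Thm. 3.2] -/
theorem CensusX41.unitCoeffCert_odd (hmod : hasEntireLFunction_rat) (hp4 : p % 4 = 3)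
    (W : WeierstrassCurve ℚ) [W.IsElliptic] [W.IsGloballyMinimal] (hadd : Addv W p)
    {q : ℚ} (hq : W.entireLFunction 1 = (q : ℂ) * (W.realPeriodRat : ℂ)) (hq0 : q ≠ 0)
    (hv : padicValRat p q = 0) :
    ∀ (V : WeierstrassCurve ℚ) [V.IsElliptic] [V.IsGloballyMinimal] (C : VariableChange ℚ),
      GoodOrd V p → C • V.quadraticTwist (-(p : ℚ)) = W →
      ∀ {N : ℕ} [NeZero N] (f : CuspForm (Gamma0 N) 2), IsNewformOf V f →
      ∀ ϖ : ℚ, (ϖ : ℝ) * V.imaginaryPeriodRat = minusPeriod f →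
      ∃ n : ℕ, ‖PowerSeries.coeff n
        (PowerSeries.C (ϖ : ℚ_[p]) * padicLFunctionMinusBranch f (unitRoot V p : ℚ_[p]) (p / 2))‖ =
          1 := by
  intro V _ _ C hV hC N _ f hf ϖ hϖ
  have hp2 : p ≠ 2 := by omega
  have hord : IsOrdinaryAt V p := (isOrdinaryAt_iff V p).mpr ⟨hV.1, hV.2⟩
  obtain ⟨hnorm, hL⟩ := CensusX41.norm_coeff_zero_odd p hmod hp4 V W C hC hord hadd hf ϖ hϖ
  refine ⟨0, ?_⟩
  set c : ℕ := (W.baseChange ℝ).numRealComponents with hc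
  have hc12 : c = 1 ∨ c = 2 := by
    rw [hc, numRealComponents]
    split_ifs
    · exact Or.inr rfl
    · exact Or.inl rfl
  have hc0 : (c : ℚ) ≠ 0 := by rcases hc12 with h | h <;> rw [h] <;> norm_num
  have hcv : padicValRat p (c : ℚ) = 0 := by
    rcases hc12 with h | h
    · rw [h, Nat.cast_one]; exact padicValRat.one
    · have h2 : padicValRat p ((2 : ℕ) : ℚ) = 0 := by
        rw [padicValRat.of_nat, Nat.cast_eq_zero]
        exact padicValNat_primes hp2
      rw [h]
      exact_mod_cast h2
  -- `ϖ⁻·S⁻ = c · q` since both sides over `c` are `L(E,1)/Ω_E`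
  have hΩ : (W.realPeriodRat : ℂ) ≠ 0 := by exact_mod_cast W.realPeriodRat_pos_holds.ne'
  have hqS : ϖ * legendreMinusSymbolSum f p = c * q := by
    have h : ((ϖ * legendreMinusSymbolSum f p / (c : ℚ) : ℚ) : ℂ) = (q : ℂ) :=
      mul_right_cancel₀ hΩ (hL.symm.trans hq)
    have h' : ϖ * legendreMinusSymbolSum f p / (c : ℚ) = q := by exact_mod_cast h
    rw [div_eq_iff hc0] at h'
    rw [h', mul_comm]
  rw [hnorm, hqS]
  refine norm_ratCast_eq_one_of_padicValRat_eq_zero p (mul_ne_zero hc0 hq0) ?_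
  rw [padicValRat.mul hc0 hq0, hcv, hv, add_zero]

end Summit.BirchSwinnertonDyer.Rank1Residual.Additive

end
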